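import Summits.AnomalousDissipation.AnomalousDissipation.Theorems.SolenoidalFractalHomogenisationRealisedQuasiStaticCellLawSectorDecayCap
import Summits.AnomalousDissipation.AnomalousDissipation.Theorems.SolenoidalFractalHomogenisationRealisedQuasiStaticCellLawLowSectorInputs
import Summits.AnomalousDissipation.AnomalousDissipation.Theorems.SolenoidalFractalHomogenisationRealisedQuasiStaticCellLawRateChoice
import HarnessLib

/-!
# K2R `RealisedQuasiStaticCellLaw`, line `floquet-bloch`: the low-sector decay with the target rate, modulo two scalar
# inequalities (helper towards `stub_lowSectorDecay`; `--supports stmt-AnomalousDissipation-20446`)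

Summits-side helper file (everything proved; no definitions, no named facts). Composition of `lowSector_inputs` (geometry),
`abs_inPlane_link_ge` (the `γ²` floor `g₁²`, `g₁ = (|ℓ·K|−|ℓ|²)/(|ℓ|(|ℓ|+|K|))`) and `sectorDecay_ae_cap` with the capped factor
`θ = e^{-c}`: for a lattice word `W`, a slot `j` in which the sector label `ℓ` has positive coupling `θ = ∑ ê_j,i ℓᵢ > 0`,
`|ℓ|² < |ℓ·K_j|`, `4|ℓ| ≤ |K_j|`, `2|ℓ| ≤ n`, and a target exponent `c ≥ 0` with
`c ≤ 8π²κ(n/2)²·w` and `log(10/3) + c ≤ Λ_j·min(2, g₁²)·(C/2)·min(C/2, C⁻¹)/80·w` (`w = τ_j(1-ρ)`, `C = 2πθ|a_j|/(nΛ_j)`),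
EVERY weak solution of the cell problem with datum in the sector satisfies
`∫‖w(t)‖² ≤ e^{c} · e^{-(c/P) t} · ∫‖w₀‖²` for a.e. `t ∈ (0,T)` (`lowSector_decay_of_rates`). The FAR case of
`stub_lowSectorDecay` is this with `c = (crux rate)·P'` at `W' = (cubatureWord.stretch M).stretch (1/ν)` (recipe v2 §(ii)).
-/

set_option linter.dupNamespace false

noncomputable section

namespace Summit.AnomalousDissipation.AnomalousDissipation.Theorems.SolenoidalFractalHomogenisation.RealisedQuasiStaticCellLaw

open Set MeasureTheory Filter Topology Function Matrix
open scoped InnerProductSpace ComplexConjugate Matrix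
open Literature.Analysis Literature.Analysis.FunctionSpaces Literature.Analysis.FunctionSpaces.Torus
open Literature.Analysis.FluidPDE Literature.Analysis.FluidPDE.LatticeShear

variable {k₀ : ℕ}

/-- **Low-sector decay at a target rate, modulo two scalar inequalities.** -/
theorem lowSector_decay_of_rates (W : LatticeWord k₀) {n : ℕ} (hn : 0 < n) {κ : ℝ} (hκ : 0 < κ)
    (ℓ : Fin 3 → ℤ) (hℓ : ℓ ≠ 0) (hℓn : 2 * ‖latticeVec ℓ‖ ≤ n) {w₀ : UnitAddTorus (Fin 3) → EuclideanSpace ℝ (Fin 3)}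
    (hw₀ : FunctionSpaces.Torus.MemSobolev 1 (FunctionSpaces.EuclideanSpace.complexify ∘ w₀))
    (hdiv : FunctionSpaces.Torus.IsWeaklyDivFree w₀) (hmean : FunctionSpaces.Torus.HasZeroMean w₀)
    (hsupp : ∀ k : Fin 3 → ℤ, ¬ ((∃ z : Fin 3 → ℤ, k = ℓ + (n:ℤ) • z) ∨ (∃ z : Fin 3 → ℤ, k = -ℓ + (n:ℤ) • z)) →
      UnitAddTorus.mFourierCoeff (FunctionSpaces.EuclideanSpace.complexify ∘ w₀) k = 0)
    (j : Fin k₀) (hθ : 0 < ∑ i, (W.phase j).e i * (ℓ i : ℝ))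
    (hfar : (fun i => ((ℓ i : ℤ) : ℝ)) ⬝ᵥ (fun i => ((ℓ i : ℤ) : ℝ)) < |(fun i => ((ℓ i : ℤ) : ℝ)) ⬝ᵥ (fun i => ((((fun i => (W.phase j).m i * (n : ℤ))) i : ℤ) : ℝ))|)
    (h4 : 4 * ‖latticeVec ℓ‖ ≤ ‖latticeVec (fun i => (W.phase j).m i * (n : ℤ))‖)
    {c : ℝ} (hc0 : 0 ≤ c)
    (hcF : c ≤ 8 * Real.pi ^ 2 * κ * ((n : ℝ) / 2) ^ 2 * ((W.phase j).τ * (1 - W.ramp)))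
    (hcP : Real.log (2 * (5 / 3)) + c ≤
      κ * (4 * Real.pi ^ 2 * freqNormSq (fun i => (W.phase j).m i * (n : ℤ))) * min 2 (((|(fun i => ((ℓ i : ℤ) : ℝ)) ⬝ᵥ (fun i => ((((fun i => (W.phase j).m i * (n : ℤ))) i : ℤ) : ℝ))| - (fun i => ((ℓ i : ℤ) : ℝ)) ⬝ᵥ (fun i => ((ℓ i : ℤ) : ℝ))) /
        (Real.sqrt ((fun i => ((ℓ i : ℤ) : ℝ)) ⬝ᵥ (fun i => ((ℓ i : ℤ) : ℝ))) * (Real.sqrt ((fun i => ((ℓ i : ℤ) : ℝ)) ⬝ᵥ (fun i => ((ℓ i : ℤ) : ℝ))) + Real.sqrt ((fun i => ((((fun i => (W.phase j).m i * (n : ℤ))) i : ℤ) : ℝ)) ⬝ᵥ (fun i => ((((fun i => (W.phase j).m i * (n : ℤ))) i : ℤ) : ℝ)))))) ^ 2) * ((2 * Real.pi * (∑ i, (W.phase j).e i * (ℓ i : ℝ)) *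
              ‖Complex.exp ((W.phase j).φ * Complex.I) *
                (1 / (2 * ((2 * Real.pi * ‖latticeVec (W.phase j).m‖ : ℝ) : ℂ) * Complex.I))‖ * (1 / (n : ℝ)) /
              (κ * (4 * Real.pi ^ 2 * freqNormSq (fun i => (W.phase j).m i * (n : ℤ))))) / 2) * min ((2 * Real.pi * (∑ i, (W.phase j).e i * (ℓ i : ℝ)) *
              ‖Complex.exp ((W.phase j).φ * Complex.I) *
                (1 / (2 * ((2 * Real.pi * ‖latticeVec (W.phase j).m‖ : ℝ) : ℂ) * Complex.I))‖ * (1 / (n : ℝ)) /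
              (κ * (4 * Real.pi ^ 2 * freqNormSq (fun i => (W.phase j).m i * (n : ℤ))))) / 2) (2 * Real.pi * (∑ i, (W.phase j).e i * (ℓ i : ℝ)) *
              ‖Complex.exp ((W.phase j).φ * Complex.I) *
                (1 / (2 * ((2 * Real.pi * ‖latticeVec (W.phase j).m‖ : ℝ) : ℂ) * Complex.I))‖ * (1 / (n : ℝ)) /
              (κ * (4 * Real.pi ^ 2 * freqNormSq (fun i => (W.phase j).m i * (n : ℤ)))))⁻¹ / 80 *
        ((W.phase j).τ * (1 - W.ramp)))
    {T : ℝ} (hT : 0 < T) {w : ℝ → UnitAddTorus (Fin 3) → EuclideanSpace ℝ (Fin 3)}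
    (hw : Torus.IsWeakPassiveVectorOn 0 T κ (W.cell n) w₀ w) :
    ∀ᵐ t ∂(volume.restrict (Ioo 0 T)), ∫ x, ‖w t x‖ ^ 2 ≤
      Real.exp c * Real.exp (-(c / W.period) * t) * ∫ x, ‖w₀ x‖ ^ 2 := by
  have hK0 : (fun i => (W.phase j).m i * (n : ℤ)) ≠ 0 := cellFreq_ne_zero (W.phase j) hn
  obtain ⟨ζr, p, hk, hζ1, hζ0, hζK, hp, hs, hγpos, hd0, hd, hd1, hdm1⟩ :=
    lowSector_inputs (W.phase j) hn hℓ hθ hfar h4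
  -- the floor `g₁² ≤ γ²`
  have hg1 := abs_inPlane_link_ge ℓ (fun i => (W.phase j).m i * (n : ℤ)) hℓ hK0 hζ1 hζ0 hζK
  rw [← hp 0, ← hp 1] at hg1
  have hg1nn : 0 ≤ ((|(fun i => ((ℓ i : ℤ) : ℝ)) ⬝ᵥ (fun i => ((((fun i => (W.phase j).m i * (n : ℤ))) i : ℤ) : ℝ))| - (fun i => ((ℓ i : ℤ) : ℝ)) ⬝ᵥ (fun i => ((ℓ i : ℤ) : ℝ))) /
        (Real.sqrt ((fun i => ((ℓ i : ℤ) : ℝ)) ⬝ᵥ (fun i => ((ℓ i : ℤ) : ℝ))) * (Real.sqrt ((fun i => ((ℓ i : ℤ) : ℝ)) ⬝ᵥ (fun i => ((ℓ i : ℤ) : ℝ))) + Real.sqrt ((fun i => ((((fun i => (W.phase j).m i * (n : ℤ))) i : ℤ) : ℝ)) ⬝ᵥ (fun i => ((((fun i => (W.phase j).m i * (n : ℤ))) i : ℤ) : ℝ)))))) := by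
    refine div_nonneg (by linarith [hfar.le]) ?_
    positivity
  have hγfloor : ((|(fun i => ((ℓ i : ℤ) : ℝ)) ⬝ᵥ (fun i => ((((fun i => (W.phase j).m i * (n : ℤ))) i : ℤ) : ℝ))| - (fun i => ((ℓ i : ℤ) : ℝ)) ⬝ᵥ (fun i => ((ℓ i : ℤ) : ℝ))) /
        (Real.sqrt ((fun i => ((ℓ i : ℤ) : ℝ)) ⬝ᵥ (fun i => ((ℓ i : ℤ) : ℝ))) * (Real.sqrt ((fun i => ((ℓ i : ℤ) : ℝ)) ⬝ᵥ (fun i => ((ℓ i : ℤ) : ℝ))) + Real.sqrt ((fun i => ((((fun i => (W.phase j).m i * (n : ℤ))) i : ℤ) : ℝ)) ⬝ᵥ (fun i => ((((fun i => (W.phase j).m i * (n : ℤ))) i : ℤ) : ℝ)))))) ^ 2 ≤ (p 0 ⬝ᵥ p 1) ^ 2 + (p (-1) ⬝ᵥ p 0) ^ 2 := by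
    have h1 : ((|(fun i => ((ℓ i : ℤ) : ℝ)) ⬝ᵥ (fun i => ((((fun i => (W.phase j).m i * (n : ℤ))) i : ℤ) : ℝ))| - (fun i => ((ℓ i : ℤ) : ℝ)) ⬝ᵥ (fun i => ((ℓ i : ℤ) : ℝ))) /
        (Real.sqrt ((fun i => ((ℓ i : ℤ) : ℝ)) ⬝ᵥ (fun i => ((ℓ i : ℤ) : ℝ))) * (Real.sqrt ((fun i => ((ℓ i : ℤ) : ℝ)) ⬝ᵥ (fun i => ((ℓ i : ℤ) : ℝ))) + Real.sqrt ((fun i => ((((fun i => (W.phase j).m i * (n : ℤ))) i : ℤ) : ℝ)) ⬝ᵥ (fun i => ((((fun i => (W.phase j).m i * (n : ℤ))) i : ℤ) : ℝ)))))) ^ 2 ≤ (p 0 ⬝ᵥ p 1) ^ 2 := by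
      rw [← sq_abs (p 0 ⬝ᵥ p 1)]
      exact pow_le_pow_left₀ hg1nn hg1 2
    nlinarith [sq_nonneg (p (-1) ⬝ᵥ p 0)]
  -- positivity of the constants
  have hKpos : 0 < freqNormSq (fun i => (W.phase j).m i * (n : ℤ)) := by
    rw [← norm_latticeVec_sq]; have := one_le_norm_latticeVec hK0; positivity
  have hΛpos : 0 < κ * (4 * Real.pi ^ 2 * freqNormSq (fun i => (W.phase j).m i * (n : ℤ))) := by positivity
  have hnApos : 0 < ‖Complex.exp ((W.phase j).φ * Complex.I) *
                (1 / (2 * ((2 * Real.pi * ‖latticeVec (W.phase j).m‖ : ℝ) : ℂ) * Complex.I))‖ :=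
    norm_pos_iff.2 (layerAmp_ne_zero (W.phase j))
  have hnpos : (0 : ℝ) < n := by exact_mod_cast hn
  obtain ⟨C, hC⟩ : ∃ C : ℝ, C = (2 * Real.pi * (∑ i, (W.phase j).e i * (ℓ i : ℝ)) *
              ‖Complex.exp ((W.phase j).φ * Complex.I) *
                (1 / (2 * ((2 * Real.pi * ‖latticeVec (W.phase j).m‖ : ℝ) : ℂ) * Complex.I))‖ * (1 / (n : ℝ)) /
              (κ * (4 * Real.pi ^ 2 * freqNormSq (fun i => (W.phase j).m i * (n : ℤ))))) := ⟨_, rfl⟩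
  have hCpos : 0 < C := by
    rw [hC]
    exact div_pos (mul_pos (mul_pos (mul_pos (mul_pos two_pos Real.pi_pos) hθ) hnApos) (by positivity)) hΛpos
  rw [← hC] at hcP
  have hX : 0 ≤ C / 2 * min (C / 2) C⁻¹ := by
    have : 0 < min (C / 2) C⁻¹ := lt_min (half_pos hCpos) (inv_pos.2 hCpos)
    positivity
  have hw0 : 0 ≤ (W.phase j).τ * (1 - W.ramp) := by
    have := (W.phase j).τ_pos; have := W.ramp_le; nlinarith
  -- the actual `r_P w` dominates the floor
  have hmin : min 2 (((|(fun i => ((ℓ i : ℤ) : ℝ)) ⬝ᵥ (fun i => ((((fun i => (W.phase j).m i * (n : ℤ))) i : ℤ) : ℝ))| - (fun i => ((ℓ i : ℤ) : ℝ)) ⬝ᵥ (fun i => ((ℓ i : ℤ) : ℝ))) /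
        (Real.sqrt ((fun i => ((ℓ i : ℤ) : ℝ)) ⬝ᵥ (fun i => ((ℓ i : ℤ) : ℝ))) * (Real.sqrt ((fun i => ((ℓ i : ℤ) : ℝ)) ⬝ᵥ (fun i => ((ℓ i : ℤ) : ℝ))) + Real.sqrt ((fun i => ((((fun i => (W.phase j).m i * (n : ℤ))) i : ℤ) : ℝ)) ⬝ᵥ (fun i => ((((fun i => (W.phase j).m i * (n : ℤ))) i : ℤ) : ℝ)))))) ^ 2) ≤ min 2 ((p 0 ⬝ᵥ p 1) ^ 2 + (p (-1) ⬝ᵥ p 0) ^ 2) := min_le_min le_rfl hγfloor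
  have hcP' : Real.log (2 * (5 / 3)) + c ≤
      κ * (4 * Real.pi ^ 2 * freqNormSq (fun i => (W.phase j).m i * (n : ℤ))) * min 2 ((p 0 ⬝ᵥ p 1) ^ 2 + (p (-1) ⬝ᵥ p 0) ^ 2) * (C / 2) *
        min (C / 2) C⁻¹ / 80 * ((W.phase j).τ * (1 - W.ramp)) := by
    refine hcP.trans ?_
    have h1 : κ * (4 * Real.pi ^ 2 * freqNormSq (fun i => (W.phase j).m i * (n : ℤ))) * min 2 (((|(fun i => ((ℓ i : ℤ) : ℝ)) ⬝ᵥ (fun i => ((((fun i => (W.phase j).m i * (n : ℤ))) i : ℤ) : ℝ))| - (fun i => ((ℓ i : ℤ) : ℝ)) ⬝ᵥ (fun i => ((ℓ i : ℤ) : ℝ))) /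
        (Real.sqrt ((fun i => ((ℓ i : ℤ) : ℝ)) ⬝ᵥ (fun i => ((ℓ i : ℤ) : ℝ))) * (Real.sqrt ((fun i => ((ℓ i : ℤ) : ℝ)) ⬝ᵥ (fun i => ((ℓ i : ℤ) : ℝ))) + Real.sqrt ((fun i => ((((fun i => (W.phase j).m i * (n : ℤ))) i : ℤ) : ℝ)) ⬝ᵥ (fun i => ((((fun i => (W.phase j).m i * (n : ℤ))) i : ℤ) : ℝ)))))) ^ 2) * (C / 2) * min (C / 2) C⁻¹ / 80 =
        (κ * (4 * Real.pi ^ 2 * freqNormSq (fun i => (W.phase j).m i * (n : ℤ)))) * (C / 2 * min (C / 2) C⁻¹) / 80 * min 2 (((|(fun i => ((ℓ i : ℤ) : ℝ)) ⬝ᵥ (fun i => ((((fun i => (W.phase j).m i * (n : ℤ))) i : ℤ) : ℝ))| - (fun i => ((ℓ i : ℤ) : ℝ)) ⬝ᵥ (fun i => ((ℓ i : ℤ) : ℝ))) /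
        (Real.sqrt ((fun i => ((ℓ i : ℤ) : ℝ)) ⬝ᵥ (fun i => ((ℓ i : ℤ) : ℝ))) * (Real.sqrt ((fun i => ((ℓ i : ℤ) : ℝ)) ⬝ᵥ (fun i => ((ℓ i : ℤ) : ℝ))) + Real.sqrt ((fun i => ((((fun i => (W.phase j).m i * (n : ℤ))) i : ℤ) : ℝ)) ⬝ᵥ (fun i => ((((fun i => (W.phase j).m i * (n : ℤ))) i : ℤ) : ℝ)))))) ^ 2) := by ring
    have h2 : κ * (4 * Real.pi ^ 2 * freqNormSq (fun i => (W.phase j).m i * (n : ℤ))) * min 2 ((p 0 ⬝ᵥ p 1) ^ 2 + (p (-1) ⬝ᵥ p 0) ^ 2) * (C / 2) *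
        min (C / 2) C⁻¹ / 80 =
        (κ * (4 * Real.pi ^ 2 * freqNormSq (fun i => (W.phase j).m i * (n : ℤ)))) * (C / 2 * min (C / 2) C⁻¹) / 80 *
          min 2 ((p 0 ⬝ᵥ p 1) ^ 2 + (p (-1) ⬝ᵥ p 0) ^ 2) := by ring
    rw [h1, h2]
    exact mul_le_mul_of_nonneg_right (mul_le_mul_of_nonneg_left hmin (by positivity)) hw0
  -- admissibility of `θ = e^{-c}`
  have hA : (1 : ℝ) ≤ 2 * (5 / 3) := by norm_num
  have hadm : min 1 (max (2 * (5 / 3) * Real.exp (-(κ * (4 * Real.pi ^ 2 * freqNormSq (fun i => (W.phase j).m i * (n : ℤ))) *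
            min 2 ((p 0 ⬝ᵥ p 1) ^ 2 + (p (-1) ⬝ᵥ p 0) ^ 2) * (C / 2) * min (C / 2) C⁻¹ / 80) *
              ((W.phase j).τ * (1 - W.ramp))))
          (Real.exp (-(8 * Real.pi ^ 2 * κ * ((n : ℝ) / 2) ^ 2) * ((W.phase j).τ * (1 - W.ramp))))) ≤ Real.exp (-c) := by
    refine (min_le_right _ _).trans (max_le ?_ ?_)
    · rw [← Real.exp_log (by norm_num : (0 : ℝ) < 2 * (5 / 3)), ← Real.exp_add, Real.exp_le_exp, neg_mul]
      linarith
    · rw [neg_mul]; exact Real.exp_le_exp.2 (by linarith)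
  have hθ1 : Real.exp (-c) ≤ 1 := by rw [← Real.exp_zero]; exact Real.exp_le_exp.2 (by linarith)
  have hmain := sectorDecay_ae_cap W hn hκ ℓ hℓn hw₀ hdiv hmean hsupp j hk hζ1 hζ0 hζK hp hs hγpos hd0 hd hd1 hdm1 hθ hT hw
    (θ := Real.exp (-c)) (by rw [← hC]; exact hadm) hθ1
  simp only [inv_exp_neg, Real.log_exp] at hmain
  exact hmain

end Summit.AnomalousDissipation.AnomalousDissipation.Theorems.SolenoidalFractalHomogenisation.RealisedQuasiStaticCellLaw

end
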